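import Summits.CriticalPhenomena.CardyFormulaZ2.Theorems.CardyMagicRigidityNestingRigidityUVCollarCrossersZ2
import Summits.CriticalPhenomena.CardyFormulaZ2.Theorems.CardyMagicRigidityNestingRigidityTowerMomentUpper
import HarnessLib

/-!
# Crux `NestingRigidity`, line `positive-cone-weight-doubling`: ASPECT-DEPENDENT exponential
# moments of the number of loops crossing a thin collar — site-`𝕋`, and both lattices (collar
# statistic, helper K `uvCollar_expMoment_latticeEnsembles`)

Crux `Summit.CriticalPhenomena.CardyFormulaZ2.Theses.CardyMagicRigidity.NestingRigidity`
(stmt-CriticalPhenomena-4835), line `positive-cone-weight-doubling`, registered helper K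
`uvCollar_expMoment_latticeEnsembles`.  Companion of `…UVCollarCrossersZ2`: the site-`𝕋` half
(`UVCollar.expMoment_collarCount_le_tEns_of`) of the aspect-dependent, Poissonian exponential moments
of the number of loops crossing a thin collar — confined arms `triArm δ (c i) (a + 3δ) (K a − 2δ)`
witnessed by the open left clusters of the counter-clockwise loops
(`BigLoopsExp.mem_foldr_triArm_of_typeOne_families`), the colour flip for the clockwise ones
(`…_compl_of_typeZero_families`, `BigLoopsExp.measure_preimage_compl_le`), one van den Berg–Kesten
product (`TowerMomentUpper.pattern_bound_tEns`), the Bollobás–Riordan annulus bound at aspect `K`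
(`TowerMomentUpper.crossing_le_tEns`), and `UVCollar.integral_exp_le_of_poissonTails` — and the
statement on BOTH lattice ensembles (registered anchor `expMoment_collarCount_le_latticeEnsembles`):
for `E ∈ latticeEnsembles` there are `α, c₀ > 0` (`c₀ ≥ 4`) such that for every aspect ratio
`K ≥ 8`, mesh `δ > 0`, radius `ρ > 0`, cell size `a ≥ c₀ δ`, order `λ ≥ 0` with
`e^{2λ}(4/K)^α ≤ 1/2` and every family `Q` of loops passing through the collar `ρ − a/2 ≤ |z| ≤ ρ`
and not inside any `B(x, K a)`, `|x| = ρ`: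
`E_δ exp(λ #{u ∈ X_δ : Q u}) ≤ exp(2 (e^{2λ} − 1) (4/K)^α (4πρ/a + 3))`.  No cited fact, no
definition.
-/

noncomputable section

open MeasureTheory Set Filter Metric
open scoped Real Topology BigOperators ENNReal

namespace Summit.CriticalPhenomena.CardyFormulaZ2.Cruxes.NestingRigidity.PositiveConeWeightDoubling

open Literature.Probability.RandomPlanarGeometry Literature.Probability.Percolation
  Literature.Probability.LatticeModels
open Summit.CriticalPhenomena.CardyFormulaZ2.Cruxes.NestingRigidity.RingCloudTomography

namespace UVCollar

/-! ## §1 Pointwise: the occupation patterns of a family of collar loops (site-`𝕋`) -/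

/-- **The occupation patterns of a family of collar loops on site-`𝕋`.**  For a site configuration
`ω` at mesh `δ > 0`, cells centred on the circle `|x| = ρ` within `a/2` of every point of it,
`a + 5δ ≤ K a`, and a family `Q` of loops passing through the collar `ρ − a/2 ≤ |z| ≤ ρ` and not
inside any `B(x, K a)`, `|x| = ρ`: there are patterns `m₀, m₁ : Fin B → Fin (M+1)` with
`#{u ∈ X_δ : Q u} ≤ Σ m₁ + Σ m₀`, `ω` in the joint disjoint occurrence of `g i` confined open arms
across `A(c i; a + 3δ, K a − 2δ)` for every `g ≤ m₁`, and `ωᶜ` in that for every `g ≤ m₀`. -/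
theorem exists_collarPatterns_tEns (ω : SiteConfig (Site 2)) {δ : ℝ} (hδ : 0 < δ) {ρ a K : ℝ}
    (hρ : 0 < ρ) (hab : a + 5 * δ ≤ K * a) {M : ℕ}
    (hM : {u ∈ (tEns.X δ ω).loops | (u.range ∩ closedBall (0 : ℂ) ρ).Nonempty}.Finite ∧
      {u ∈ (tEns.X δ ω).loops | (u.range ∩ closedBall (0 : ℂ) ρ).Nonempty}.ncard ≤ M)
    {B : ℕ} {c : Fin B → ℂ} (hcn : ∀ i, ‖c i‖ = ρ)
    (hc : ∀ w : ℂ, ‖w‖ = ρ → ∃ i, dist w (c i) ≤ a / 2) (Q : UnbasedLoop ℂ → Prop)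
    (hQ : ∀ u, Q u → (∃ z ∈ u.range, ρ - a / 2 ≤ ‖z‖ ∧ ‖z‖ ≤ ρ) ∧
      ∀ x : ℂ, ‖x‖ = ρ → (u.range ∩ (ball x (K * a))ᶜ).Nonempty) :
    ∃ m₀ m₁ : Fin B → Fin (M + 1),
      {u ∈ (tEns.X δ ω).loops | Q u}.ncard ≤ ∑ i, (m₁ i : ℕ) + ∑ i, (m₀ i : ℕ) ∧
      (∀ g : Fin B → ℕ, (∀ i, g i ≤ m₁ i) → ω ∈ (List.ofFn fun i ↦ disjointOccurrencePow
        (triArm δ (c i) (a + 3 * δ) (K * a - 2 * δ)) (g i)).foldr disjointOccurrence univ) ∧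
      (∀ g : Fin B → ℕ, (∀ i, g i ≤ m₀ i) → ωᶜ ∈ (List.ofFn fun i ↦ disjointOccurrencePow
        (triArm δ (c i) (a + 3 * δ) (K * a - 2 * δ)) (g i)).foldr disjointOccurrence univ) := by
  -- the typed families
  set S : Fin 2 → Set (UnbasedLoop ℂ) := fun t ↦ {u ∈ (siteLoopConfig δ ω).F t | Q u} with hS
  have hSsub : ∀ t, S t ⊆ {u ∈ (tEns.X δ ω).loops | (u.range ∩ closedBall (0 : ℂ) ρ).Nonempty} := by
    rintro t u ⟨hu, hq⟩
    refine ⟨?_, ?_⟩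
    · change u ∈ (siteLoopConfig δ ω).loops
      rw [LoopConfig.mem_loops_iff]
      fin_cases t
      · exact Or.inl hu
      · exact Or.inr hu
    · obtain ⟨z, hz, -, hz2⟩ := (hQ u hq).1
      exact ⟨z, hz, mem_closedBall_zero_iff.2 hz2⟩
  have hSfin : ∀ t, (S t).Finite := fun t ↦ hM.1.subset (hSsub t)
  have hSM : ∀ t, (S t).ncard ≤ M := fun t ↦ (Set.ncard_le_ncard (hSsub t) hM.1).trans hM.2
  have hcell : ∀ t, ∀ u ∈ S t, ∃ i, (u.range ∩ closedBall (c i) a).Nonempty ∧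
      (u.range ∩ (ball (c i) (K * a))ᶜ).Nonempty := by
    rintro t u ⟨-, hq⟩
    obtain ⟨⟨z, hz, hz1, hz2⟩, hfar⟩ := hQ u hq
    obtain ⟨i, hi⟩ := exists_cell_of_collar hρ hc hz1 hz2
    exact ⟨i, ⟨z, hz, mem_closedBall.2 hi⟩, hfar (c i) (hcn i)⟩
  -- the count splits by type
  have hcount : {u ∈ (tEns.X δ ω).loops | Q u}.ncard ≤ (S 0).ncard + (S 1).ncard := by
    have heq : {u ∈ (tEns.X δ ω).loops | Q u} = S 0 ∪ S 1 := by
      ext u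
      simp only [hS, Set.mem_setOf_eq, Set.mem_union]
      change (u ∈ (siteLoopConfig δ ω).loops ∧ _) ↔ _
      rw [LoopConfig.mem_loops_iff]
      tauto
    rw [heq]
    exact Set.ncard_union_le _ _
  obtain ⟨T₀, m₀, hT₀S, hT₀fin, hT₀disj, hmeet₀, hm₀, hsum₀⟩ :=
    exists_families_of_cells (hSfin 0) (hSM 0) c (fun _ ↦ a) (fun _ ↦ K * a) (hcell 0)
  obtain ⟨T₁, m₁, hT₁S, hT₁fin, hT₁disj, hmeet₁, hm₁, hsum₁⟩ :=
    exists_families_of_cells (hSfin 1) (hSM 1) c (fun _ ↦ a) (fun _ ↦ K * a) (hcell 1)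
  refine ⟨m₀, m₁, ?_, fun g hg ↦ ?_, fun g hg ↦ ?_⟩
  · rw [hsum₀, hsum₁, add_comm]; exact hcount
  · exact BigLoopsExp.mem_foldr_triArm_of_typeOne_families hδ (a := fun _ ↦ a) (b := fun _ ↦ K * a)
      (fun _ ↦ hab) c T₁ (fun i u hu ↦ (hT₁S i hu).1) hT₁fin hT₁disj hmeet₁ g
      fun i ↦ (hg i).trans (hm₁ i).le
  · exact BigLoopsExp.mem_foldr_triArm_compl_of_typeZero_families hδ (a := fun _ ↦ a)
      (b := fun _ ↦ K * a) (fun _ ↦ hab) c T₀ (fun i u hu ↦ (hT₀S i hu).1) hT₀fin hT₀disj hmeet₀ g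
      fun i ↦ (hg i).trans (hm₀ i).le

/-! ## §2 The bound on site-`𝕋` -/

/-- **Aspect-dependent exponential moments of a collar crossing count, site-`𝕋`** (with the exponent
`α` of `tri_annulusCrossing_bound_holds`; cell size `a ≥ 1000 δ`). -/
theorem expMoment_collarCount_le_tEns_of {α : ℝ} (hα : 0 < α)
    (hbd : ∀ (b : Bool) (δ : ℝ) (z : ℂ) (r₁ r₂ : ℝ), 0 < δ → 1000 * δ ≤ r₁ → 2 * r₁ ≤ r₂ →
      (triSitePercolation half).real (triAnnulusCrossing b δ z r₁ r₂) ≤ (r₁ / r₂) ^ α)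
    {K : ℝ} (hK : 8 ≤ K) {δ ρ a l : ℝ} (hδ : 0 < δ) (ha : 1000 * δ ≤ a) (hρ : 0 < ρ)
    (hl : 0 ≤ l) (hq : Real.exp (2 * l) * (4 / K) ^ α ≤ 1 / 2) (Q : UnbasedLoop ℂ → Prop)
    (hQ : ∀ u, Q u → (∃ z ∈ u.range, ρ - a / 2 ≤ ‖z‖ ∧ ‖z‖ ≤ ρ) ∧
      ∀ x : ℂ, ‖x‖ = ρ → (u.range ∩ (ball x (K * a))ᶜ).Nonempty) :
    Integrable (fun ω ↦ Real.exp (l * ({u ∈ (tEns.X δ ω).loops | Q u}.ncard : ℝ))) tEns.P ∧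
    ∫ ω, Real.exp (l * ({u ∈ (tEns.X δ ω).loops | Q u}.ncard : ℝ)) ∂tEns.P ≤
      Real.exp (2 * (Real.exp (2 * l) - 1) * (4 / K) ^ α * (4 * π * ρ / a + 3)) := by
  haveI := isProbabilityMeasure_of_mem tEns_mem
  have ha0 : 0 < a := by linarith
  have hQρ : ∀ u, Q u → (u.range ∩ closedBall (0 : ℂ) ρ).Nonempty := fun u hu ↦ by
    obtain ⟨z, hz, -, hz2⟩ := (hQ u hu).1
    exact ⟨z, hz, mem_closedBall_zero_iff.2 hz2⟩
  refine ⟨integrable_exp_mul_ncard tEns tEns_mem hδ ρ l Q hQρ, ?_⟩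
  obtain ⟨B, c, hB, hcn, hc⟩ := exists_circle_cells hρ ha0
  have hab : a + 5 * δ ≤ K * a := by nlinarith
  obtain ⟨M, hM⟩ := FirstMoment.exists_ncard_loops_meeting_le tEns tEns_mem hδ ρ
  set p : ℝ := (4 / K) ^ α with hp
  have hp0 : 0 ≤ p := by positivity
  have hpc : ∀ x : ℂ, (triSitePercolation half).real (triArm δ x (a + 3 * δ) (K * a - 2 * δ)) ≤ p :=
    fun x ↦ TowerMomentUpper.crossing_le_tEns hα hbd hK hδ ha x
  set D₁ : (Fin B → ℕ) → Set (SiteConfig (Site 2)) := fun g ↦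
    (List.ofFn fun i ↦ disjointOccurrencePow (triArm δ (c i) (a + 3 * δ) (K * a - 2 * δ))
      (g i)).foldr disjointOccurrence univ with hD₁
  set D₀ : (Fin B → ℕ) → Set (SiteConfig (Site 2)) := fun g ↦ compl ⁻¹'
    (List.ofFn fun i ↦ disjointOccurrencePow (triArm δ (c i) (a + 3 * δ) (K * a - 2 * δ))
      (g i)).foldr disjointOccurrence univ with hD₀
  have h₁ : ∀ g, MeasurableSet (D₁ g) ∧ tEns.P.real (D₁ g) ≤ ∏ i, p ^ (g i) := fun g ↦
    TowerMomentUpper.pattern_bound_tEns hδ c (fun _ ↦ a + 3 * δ) (fun _ ↦ K * a - 2 * δ)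
      (fun i ↦ hpc (c i)) g
  have h₀ : ∀ g, MeasurableSet (D₀ g) ∧ tEns.P.real (D₀ g) ≤ ∏ i, p ^ (g i) := by
    intro g
    obtain ⟨hmeas, hle⟩ := h₁ g
    exact ⟨measurableSet_preimage measurable_compl hmeas,
      (ENNReal.toReal_mono (measure_ne_top _ _) (BigLoopsExp.measure_preimage_compl_le _)).trans hle⟩
  have key := integral_exp_le_of_poissonTails tEns.P hl hp0 hq D₁ D₀ (fun g ↦ (h₁ g).1)
    (fun g ↦ (h₀ g).1) (fun g ↦ (h₁ g).2) (fun g ↦ (h₀ g).2) (M := M)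
    (fun ω ↦ {u ∈ (tEns.X δ ω).loops | Q u}.ncard)
    (Eventually.of_forall fun ω ↦ by
      obtain ⟨m₀, m₁, hN, h1, h0⟩ := exists_collarPatterns_tEns ω hδ hρ hab (hM ω) hcn hc Q hQ
      exact ⟨fun i ↦ (m₁ i : ℕ), fun i ↦ (m₀ i : ℕ), fun i ↦ Nat.lt_succ_iff.1 (m₁ i).2,
        fun i ↦ Nat.lt_succ_iff.1 (m₀ i).2, h1, h0, hN⟩)
  refine key.trans (Real.exp_le_exp.2 (mul_le_mul_of_nonneg_left hB ?_))
  have : 0 ≤ Real.exp (2 * l) - 1 := by linarith [Real.one_le_exp (by positivity : 0 ≤ 2 * l)]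
  positivity

/-- **Aspect-dependent exponential moments of a collar crossing count, site-`𝕋`**: there are
`α, c₀ > 0` (`c₀ ≥ 4`) as in the module docstring (`c₀ = 1000`). -/
theorem expMoment_collarCount_le_tEns : ∃ α c₀ : ℝ, 0 < α ∧ 4 ≤ c₀ ∧ ∀ (K δ ρ a l : ℝ)
    (Q : UnbasedLoop ℂ → Prop), 8 ≤ K → 0 < δ → c₀ * δ ≤ a → 0 < ρ → 0 ≤ l →
    Real.exp (2 * l) * (4 / K) ^ α ≤ 1 / 2 →
    (∀ u, Q u → (∃ z ∈ u.range, ρ - a / 2 ≤ ‖z‖ ∧ ‖z‖ ≤ ρ) ∧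
      ∀ x : ℂ, ‖x‖ = ρ → (u.range ∩ (Metric.ball x (K * a))ᶜ).Nonempty) →
    Integrable (fun ω ↦ Real.exp (l * ({u ∈ (tEns.X δ ω).loops | Q u}.ncard : ℝ))) tEns.P ∧
    ∫ ω, Real.exp (l * ({u ∈ (tEns.X δ ω).loops | Q u}.ncard : ℝ)) ∂tEns.P ≤
      Real.exp (2 * (Real.exp (2 * l) - 1) * (4 / K) ^ α * (4 * π * ρ / a + 3)) := by
  obtain ⟨α, hα, hbd⟩ := tri_annulusCrossing_bound_holds
  exact ⟨α, 1000, hα, by norm_num, fun K δ ρ a l Q hK hδ ha hρ hl hq hQ ↦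
    expMoment_collarCount_le_tEns_of hα hbd hK hδ ha hρ hl hq Q hQ⟩

end UVCollar

/-! ## §3 Both lattice ensembles (registered anchor) -/

/-- **Anchor (helper toward K `uvCollar_expMoment_latticeEnsembles`): aspect-dependent, Poissonian
exponential moments of the number of loops crossing a thin collar, BOTH lattices.**  For
`E ∈ latticeEnsembles` there are `α, c₀ > 0`, `c₀ ≥ 4`, such that for every aspect ratio `K ≥ 8`,
mesh `δ > 0`, radius `ρ > 0`, cell size `a ≥ c₀ δ`, order `λ ≥ 0` with `e^{2λ}(4/K)^α ≤ 1/2`, and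
every family `Q` of loops each passing through the thin collar `ρ − a/2 ≤ |z| ≤ ρ` and not drawn
inside any ball `B(x, K a)` centred on the circle `|x| = ρ` (big crossers, exit loops, …):
`E_δ exp(λ #{u ∈ X_δ : Q u}) ≤ exp(2 (e^{2λ} − 1) (4/K)^α (4πρ/a + 3))`, integrability included —
the rate of `≤ 4πρ/a + 3` independent rare cells of intensity `(4/K)^α`, small in `λ` and in `1/K`
(`expMoment_collarCount_le_zEns`, `UVCollar.expMoment_collarCount_le_tEns`). -/
theorem expMoment_collarCount_le_latticeEnsembles : ∀ E ∈ latticeEnsembles, ∃ α c₀ : ℝ, 0 < α ∧ 4 ≤ c₀ ∧ ∀ (K δ ρ a l : ℝ) (Q : UnbasedLoop ℂ → Prop), 8 ≤ K → 0 < δ → c₀ * δ ≤ a → 0 < ρ → 0 ≤ l → Real.exp (2 * l) * (4 / K) ^ α ≤ 1 / 2 → (∀ u, Q u → (∃ z ∈ u.range, ρ - a / 2 ≤ ‖z‖ ∧ ‖z‖ ≤ ρ) ∧ ∀ x : ℂ, ‖x‖ = ρ → (u.range ∩ (Metric.ball x (K * a))ᶜ).Nonempty) → Integrable (fun ω ↦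 Real.exp (l * ({u ∈ (E.X δ ω).loops | Q u}.ncard : ℝ))) E.P ∧ ∫ ω, Real.exp (l * ({u ∈ (E.X δ ω).loops | Q u}.ncard : ℝ)) ∂E.P ≤ Real.exp (2 * (Real.exp (2 * l) - 1) * (4 / K) ^ α * (4 * π * ρ / a + 3)) := by
  intro E hE
  simp only [latticeEnsembles, Set.mem_insert_iff, Set.mem_singleton_iff] at hE
  rcases hE with rfl | rfl
  · exact expMoment_collarCount_le_zEns
  · exact UVCollar.expMoment_collarCount_le_tEns

end Summit.CriticalPhenomena.CardyFormulaZ2.Cruxes.NestingRigidity.PositiveConeWeightDoubling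

end
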